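import Literature.MathematicalPhysics.QuantumLattice.HeisenbergModelGlobalRotationProofs
import Literature.MathematicalPhysics.QuantumLattice.SpinOperatorsProofs
import HarnessLib

/-!
# Ladder operators of the total spin (towards the Lieb–Mattis theorem)

Sibling proof file (theorems only, no definitions) of
`Literature/MathematicalPhysics/QuantumLattice/SpinChains.lean`, first of the files discharging
the named fact `marshall_lieb_mattis_spin` (Lieb–Mattis, J. Math. Phys. 3 (1962) 749, Thm 2;
Tasaki (2020) Thm 2.3). It records the elementary `SU(2)` ladder algebra of the total spin of a
finite spin-`n/2` system on `Λ`, in the concrete `ℓ²(Λ → Fin (n+1))` picture of `SpinSystem.lean`: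

* `Ŝᶻ_tot = totalSpin n 2` is the diagonal matrix `σ ↦ Σ_x (n/2 - σ_x)` (`totalSpin_two_eq_diagonal`),
  so the magnetisation sector `spinZSector n M` is the coordinate subspace of vectors supported on
  the configurations of magnetisation `M`, equivalently of weight `W = Σ_x σ_x = |Λ| n/2 - M`
  (`mem_spinZSector_iff`, `mem_spinZSector_weight_iff`);
* the raising / lowering operators `Ŝ^±_tot = Ŝˣ_tot ± i Ŝʸ_tot = Σ_x S^±_x`
  (`totalSpin_raise_eq_sum_onSite`, `totalSpin_lower_eq_sum_onSite`), adjoint to each other;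
* the commutators `[Ŝ⁺, Ŝ⁻] = 2 Ŝᶻ`, `[Ŝᶻ, Ŝ^±] = ± Ŝ^±`, `[Ŝᵃ_tot, Ŝᵇ_tot] = Σ_x ([Sᵃ, Sᵇ])_x`;
* the Casimir identities `(𝐒_tot)² = Ŝ⁻Ŝ⁺ + (Ŝᶻ)² + Ŝᶻ = Ŝ⁺Ŝ⁻ + (Ŝᶻ)² - Ŝᶻ` and
  `[(𝐒_tot)², Ŝᵇ_tot] = 0`.

Everything is written without new definitions: `Ŝ⁺_tot` appears literally as
`totalSpin n 0 + I • totalSpin n 1` and `Ŝ⁻_tot` as `totalSpin n 0 - I • totalSpin n 1`.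

## Sources

H. Tasaki, *Physics and Mathematics of Quantum Many-Body Systems* (Springer, 2020), §2.2
(eqs. (2.2.7)–(2.2.13)) and App. A.3; A. Messiah, *Quantum Mechanics* II, ch. XIII §§4–6. All
statements are finite-dimensional matrix algebra. [folklore]
-/

noncomputable section

open Matrix Complex Finset

namespace Literature.MathematicalPhysics.QuantumLattice

namespace LiebMattis

section QLattice

variable {Λ : Type*} [Fintype Λ] [DecidableEq Λ] {q : ℕ}

/-! ### Single-site operators: diagonal matrices and commutators of sums -/

/-- A diagonal single-site matrix placed at `x` is diagonal: `(diag d)_x = diag (σ ↦ d (σ x))`.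
[folklore] -/
theorem onSite_diagonal (x : Λ) (d : Fin q → ℂ) :
    (onSite x (diagonal d) : Op Λ q) = diagonal fun σ => d (σ x) := by
  ext σ τ
  rw [onSite_apply, diagonal_apply, diagonal_apply]
  by_cases hστ : σ = τ
  · subst hστ
    simp
  · rw [if_neg hστ]
    split_ifs with h1 h2
    · exact absurd (funext fun y => if hy : y = x then hy ▸ h2 else h1 y hy) hστ
    · rfl
    · rfl

/-- **Commutator of two sums of single-site operators**:
`[Σ_x a_x, Σ_x b_x] = Σ_x ([a, b])_x` (operators at distinct sites commute). Tasaki (2020) §2.2,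
eqs. (2.2.6), (2.2.11). [folklore] -/
theorem sum_onSite_commutator (a b : Matrix (Fin q) (Fin q) ℂ) :
    ((∑ x, onSite x a) * (∑ x, onSite x b) - (∑ x, onSite x b) * (∑ x, onSite x a) : Op Λ q) =
      ∑ x, onSite x (a * b - b * a) := by
  have key : ∀ x z : Λ, (onSite x a * onSite z b : Op Λ q) =
      onSite z b * onSite x a + if z = x then onSite x (a * b - b * a) else 0 := by
    intro x z
    by_cases hz : z = x
    · subst hz
      rw [if_pos rfl, onSite_mul, onSite_mul, ← onSite_add']
      congr 1
      abel
    · rw [if_neg hz, add_zero]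
      exact onSite_mul_onSite_comm (Ne.symm hz) _ _
  rw [Finset.sum_mul_sum, Finset.sum_mul_sum, Finset.sum_comm (f := fun z x => onSite z b * onSite x a),
    ← Finset.sum_sub_distrib]
  refine Finset.sum_congr rfl fun x _ => ?_
  rw [← Finset.sum_sub_distrib]
  rw [Finset.sum_congr rfl fun z _ => show (onSite x a * onSite z b - onSite z b * onSite x a : Op Λ q) =
      if z = x then onSite x (a * b - b * a) else 0 by rw [key, add_sub_cancel_left]]
  rw [Finset.sum_ite_eq', if_pos (Finset.mem_univ x)]

variable (n : ℕ)

/-! ### `Ŝᶻ_tot` is diagonal; magnetisation sectors are coordinate subspaces -/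

/-- **`Ŝᶻ_tot` is diagonal in the product basis**, with entry `Σ_x (n/2 - σ_x)` (the magnetisation
of the configuration `σ`; basis convention `σ_x = k ↔ m = n/2 - k`). Tasaki (2020) §2.2,
eq. (2.2.10). [folklore] -/
theorem totalSpin_two_eq_diagonal :
    (totalSpin n 2 : Op Λ (n + 1)) = diagonal fun σ => ∑ x, ((n : ℂ) / 2 - ((σ x : ℕ) : ℂ)) := by
  have h : ∀ x : Λ, (siteSpin n x 2 : Op Λ (n + 1)) =
      diagonal fun σ => ((n : ℂ) / 2 - ((σ x : ℕ) : ℂ)) := fun x => by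
    rw [siteSpin, spinVec_two, SpinOperators.spinZ, onSite_diagonal]
  rw [totalSpin, Finset.sum_congr rfl fun x _ => h x]
  ext σ τ
  rw [Matrix.sum_apply, diagonal_apply]
  simp only [diagonal_apply]
  split_ifs with hστ
  · rfl
  · simp

/-- **Magnetisation sectors are coordinate subspaces**: `ψ ∈ 𝓗_M` iff `ψ` is supported on the
configurations of magnetisation `Σ_x (n/2 - σ_x) = M`. Tasaki (2020) §2.2, eq. (2.2.10); §2.4,
eq. (2.4.5). [folklore] -/
theorem mem_spinZSector_iff (M : ℝ) (ψ : TensorIndex Λ (n + 1) → ℂ) :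
    ψ ∈ spinZSector n M ↔
      ∀ σ, ψ σ ≠ 0 → (∑ x, ((n : ℂ) / 2 - ((σ x : ℕ) : ℂ))) = (M : ℂ) := by
  rw [spinZSector, Module.End.mem_eigenspace_iff, Matrix.toLin'_apply, totalSpin_two_eq_diagonal]
  constructor
  · intro h σ hσ
    have h1 := congrFun h σ
    rw [mulVec_diagonal, Pi.smul_apply, smul_eq_mul] at h1
    exact mul_right_cancel₀ hσ h1
  · intro h
    funext σ
    rw [mulVec_diagonal, Pi.smul_apply, smul_eq_mul]
    by_cases hσ : ψ σ = 0
    · rw [hσ, mul_zero, mul_zero]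
    · rw [h σ hσ]

omit [DecidableEq Λ] in
/-- The magnetisation of a configuration in terms of its weight `W(σ) = Σ_x σ_x`:
`Σ_x (n/2 - σ_x) = |Λ| n / 2 - W(σ)`. [folklore] -/
theorem magnetisation_eq_sub_weight (σ : TensorIndex Λ (n + 1)) :
    (∑ x, ((n : ℂ) / 2 - ((σ x : ℕ) : ℂ))) =
      ((Fintype.card Λ * n : ℕ) : ℂ) / 2 - ((∑ x, (σ x : ℕ) : ℕ) : ℂ) := by
  rw [Finset.sum_sub_distrib, Finset.sum_const, Finset.card_univ, nsmul_eq_mul]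
  push_cast
  ring

/-- **Sectors by weight**: for `W : ℕ`, the sector of magnetisation `M = |Λ| n/2 - W` consists of
the vectors supported on the configurations of weight `Σ_x σ_x = W`. Tasaki (2020) §2.4,
eq. (2.4.5). [folklore] -/
theorem mem_spinZSector_weight_iff (W : ℕ) (ψ : TensorIndex Λ (n + 1) → ℂ) :
    ψ ∈ spinZSector n (((Fintype.card Λ * n : ℕ) : ℝ) / 2 - W) ↔
      ∀ σ, (∑ x, (σ x : ℕ)) ≠ W → ψ σ = 0 := by
  rw [mem_spinZSector_iff]
  refine forall_congr' fun σ => ?_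
  rw [magnetisation_eq_sub_weight]
  push_cast
  constructor
  · intro h hW
    by_contra hψ
    have h1 := h hψ
    have h2 : ((∑ x, (σ x : ℕ) : ℕ) : ℂ) = (W : ℂ) := by
      have := congrArg (fun z => ((Fintype.card Λ : ℂ) * n) / 2 - z) h1
      simpa using this
    exact hW (by exact_mod_cast h2)
  · intro h hψ
    have hW : (∑ x, (σ x : ℕ)) = W := by
      by_contra hW
      exact hψ (h hW)
    rw [← hW]
    push_cast
    rfl

/-! ### Raising and lowering operators -/

/-- `Sˣ + i Sʸ = S⁺` for a single spin. Tasaki (2020) §2.1, eq. (2.1.6). [folklore] -/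
theorem spinX_add_I_smul_spinY : spinX n + I • spinY n = spinRaise n := by
  rw [spinX, spinY, smul_smul]
  have h : I * (1 / (2 * I)) = 1 / 2 := by
    field_simp
  rw [h, ← smul_add]
  have h2 : spinRaise n + spinLower n + (spinRaise n - spinLower n) = (2 : ℂ) • spinRaise n := by
    rw [two_smul]
    abel
  rw [h2, smul_smul]
  norm_num

/-- `Sˣ - i Sʸ = S⁻` for a single spin. Tasaki (2020) §2.1, eq. (2.1.6). [folklore] -/
theorem spinX_sub_I_smul_spinY : spinX n - I • spinY n = spinLower n := by
  rw [spinX, spinY, smul_smul]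
  have h : I * (1 / (2 * I)) = 1 / 2 := by
    field_simp
  rw [h, ← smul_sub]
  have h2 : spinRaise n + spinLower n - (spinRaise n - spinLower n) = (2 : ℂ) • spinLower n := by
    rw [two_smul]
    abel
  rw [h2, smul_smul]
  norm_num

/-- **`Ŝ⁺_tot = Ŝˣ_tot + i Ŝʸ_tot = Σ_x S⁺_x`.** Tasaki (2020) §2.2, eq. (2.2.11); App. A.3.
[folklore] -/
theorem totalSpin_raise_eq_sum_onSite :
    (totalSpin n 0 + I • totalSpin n 1 : Op Λ (n + 1)) = ∑ x, onSite x (spinRaise n) := by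
  simp only [totalSpin, siteSpin, spinVec_zero, spinVec_one, Finset.smul_sum,
    ← Finset.sum_add_distrib, ← onSite_smul', ← onSite_add', spinX_add_I_smul_spinY]

/-- **`Ŝ⁻_tot = Ŝˣ_tot - i Ŝʸ_tot = Σ_x S⁻_x`.** Tasaki (2020) §2.2, eq. (2.2.11); App. A.3.
[folklore] -/
theorem totalSpin_lower_eq_sum_onSite :
    (totalSpin n 0 - I • totalSpin n 1 : Op Λ (n + 1)) = ∑ x, onSite x (spinLower n) := by
  simp only [totalSpin, siteSpin, spinVec_zero, spinVec_one, Finset.smul_sum,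
    ← Finset.sum_sub_distrib, ← onSite_smul', ← onSite_sub', spinX_sub_I_smul_spinY]

/-- `Ŝᶻ_tot = Σ_x Sᶻ_x` as a sum of single-site operators. Tasaki (2020) §2.2, eq. (2.2.11).
[folklore] -/
theorem totalSpin_two_eq_sum_onSite :
    (totalSpin n 2 : Op Λ (n + 1)) = ∑ x, onSite x (SpinOperators.spinZ n) := by
  simp only [totalSpin, siteSpin, spinVec_two]

/-- **`(Ŝ⁺_tot)ᴴ = Ŝ⁻_tot`.** Tasaki (2020) §2.2. [folklore] -/
theorem conjTranspose_totalSpin_raise :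
    (totalSpin n 0 + I • totalSpin n 1 : Op Λ (n + 1))ᴴ = totalSpin n 0 - I • totalSpin n 1 := by
  rw [conjTranspose_add, conjTranspose_smul, (totalSpin_isHermitian n 0).eq,
    (totalSpin_isHermitian n 1).eq, Complex.star_def, conj_I, neg_smul, sub_eq_add_neg]

/-- **`(Ŝ⁻_tot)ᴴ = Ŝ⁺_tot`.** Tasaki (2020) §2.2. [folklore] -/
theorem conjTranspose_totalSpin_lower :
    (totalSpin n 0 - I • totalSpin n 1 : Op Λ (n + 1))ᴴ = totalSpin n 0 + I • totalSpin n 1 := by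
  rw [conjTranspose_sub, conjTranspose_smul, (totalSpin_isHermitian n 0).eq,
    (totalSpin_isHermitian n 1).eq, Complex.star_def, conj_I, neg_smul, sub_neg_eq_add]

/-! ### Commutators of the total spin -/

/-- **`[Ŝᵃ_tot, Ŝᵇ_tot] = Σ_x ([Sᵃ, Sᵇ])_x`.** Tasaki (2020) §2.2, eqs. (2.2.6), (2.2.11).
[folklore] -/
theorem totalSpin_commutator (a b : Fin 3) :
    (totalSpin n a * totalSpin n b - totalSpin n b * totalSpin n a : Op Λ (n + 1)) =
      ∑ x, onSite x ⁅spinVec n a, spinVec n b⁆ := by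
  conv_lhs => rw [show (totalSpin n a : Op Λ (n + 1)) = ∑ x, siteSpin n x a from rfl,
    Finset.sum_mul, Finset.mul_sum, ← Finset.sum_sub_distrib]
  exact Finset.sum_congr rfl fun x _ => siteSpin_mul_totalSpin_sub n x a b

/-- **`[Ŝˣ_tot, Ŝʸ_tot] = i Ŝᶻ_tot`.** Tasaki (2020) §2.2, eq. (2.2.11) with (2.1.1). [folklore] -/
theorem totalSpin_zero_commutator_one :
    (totalSpin n 0 * totalSpin n 1 - totalSpin n 1 * totalSpin n 0 : Op Λ (n + 1)) =
      I • totalSpin n 2 := by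
  rw [totalSpin_commutator, totalSpin_two_eq_sum_onSite, Finset.smul_sum]
  refine Finset.sum_congr rfl fun x _ => ?_
  rw [spinVec_zero, spinVec_one, lie_spinX_spinY, onSite_smul']

/-- **`[Ŝ⁺_tot, Ŝ⁻_tot] = 2 Ŝᶻ_tot`.** Tasaki (2020) §2.2 with eq. (2.1.7); Messiah XIII.(24).
[folklore] -/
theorem totalSpin_raise_commutator_lower :
    ((totalSpin n 0 + I • totalSpin n 1) * (totalSpin n 0 - I • totalSpin n 1) -
        (totalSpin n 0 - I • totalSpin n 1) * (totalSpin n 0 + I • totalSpin n 1) : Op Λ (n + 1)) =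
      (2 : ℂ) • totalSpin n 2 := by
  rw [totalSpin_raise_eq_sum_onSite, totalSpin_lower_eq_sum_onSite, sum_onSite_commutator,
    spinRaise_commutator_spinLower, totalSpin_two_eq_sum_onSite, Finset.smul_sum]
  refine Finset.sum_congr rfl fun x _ => ?_
  rw [onSite_smul']

/-- **`[Ŝᶻ_tot, Ŝ⁺_tot] = Ŝ⁺_tot`.** Tasaki (2020) §2.2 with eq. (2.1.7); Messiah XIII.(23).
[folklore] -/
theorem totalSpin_two_commutator_raise :
    (totalSpin n 2 * (totalSpin n 0 + I • totalSpin n 1) -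
        (totalSpin n 0 + I • totalSpin n 1) * totalSpin n 2 : Op Λ (n + 1)) =
      totalSpin n 0 + I • totalSpin n 1 := by
  rw [totalSpin_raise_eq_sum_onSite, totalSpin_two_eq_sum_onSite, sum_onSite_commutator,
    spinZ_commutator_spinRaise]

/-- **`[Ŝᶻ_tot, Ŝ⁻_tot] = -Ŝ⁻_tot`.** Tasaki (2020) §2.2 with eq. (2.1.7). [folklore] -/
theorem totalSpin_two_commutator_lower :
    (totalSpin n 2 * (totalSpin n 0 - I • totalSpin n 1) -
        (totalSpin n 0 - I • totalSpin n 1) * totalSpin n 2 : Op Λ (n + 1)) =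
      -(totalSpin n 0 - I • totalSpin n 1) := by
  rw [totalSpin_lower_eq_sum_onSite, totalSpin_two_eq_sum_onSite, sum_onSite_commutator,
    spinZ_commutator_spinLower, ← Finset.sum_neg_distrib]
  refine Finset.sum_congr rfl fun x _ => ?_
  rw [onSite_neg']

/-! ### The Casimir operator in terms of the ladder operators -/

/-- **`(𝐒_tot)² = Ŝ⁻_tot Ŝ⁺_tot + (Ŝᶻ_tot)² + Ŝᶻ_tot`.** Tasaki (2020) §2.2, eq. (2.2.13) with
App. A.3, eq. (A.3.8); Messiah XIII.(25). [folklore] -/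
theorem totalSpinSq_eq_lower_mul_raise :
    (totalSpinSq n : Op Λ (n + 1)) =
      (totalSpin n 0 - I • totalSpin n 1) * (totalSpin n 0 + I • totalSpin n 1) +
        totalSpin n 2 * totalSpin n 2 + totalSpin n 2 := by
  have hc := totalSpin_zero_commutator_one (Λ := Λ) n
  have expand : ((totalSpin n 0 - I • totalSpin n 1) * (totalSpin n 0 + I • totalSpin n 1) :
      Op Λ (n + 1)) =
      totalSpin n 0 * totalSpin n 0 + totalSpin n 1 * totalSpin n 1 +
        I • (totalSpin n 0 * totalSpin n 1 - totalSpin n 1 * totalSpin n 0) := by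
    simp only [sub_mul, mul_add, smul_mul_assoc, mul_smul_comm, smul_sub, smul_smul, I_mul_I,
      neg_one_smul]
    abel
  rw [expand, hc, smul_smul, I_mul_I, neg_one_smul, totalSpinSq, Fin.sum_univ_three]
  abel

/-- **`(𝐒_tot)² = Ŝ⁺_tot Ŝ⁻_tot + (Ŝᶻ_tot)² - Ŝᶻ_tot`.** Tasaki (2020) §2.2, eq. (2.2.13) with
App. A.3; Messiah XIII.(25). [folklore] -/
theorem totalSpinSq_eq_raise_mul_lower :
    (totalSpinSq n : Op Λ (n + 1)) =
      (totalSpin n 0 + I • totalSpin n 1) * (totalSpin n 0 - I • totalSpin n 1) +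
        totalSpin n 2 * totalSpin n 2 - totalSpin n 2 := by
  have h := totalSpin_raise_commutator_lower (Λ := Λ) n
  rw [totalSpinSq_eq_lower_mul_raise]
  rw [sub_eq_iff_eq_add] at h
  rw [h, two_smul]
  abel

/-- **`[(𝐒_tot)², Ŝᵇ_tot] = 0`**: the total spin Casimir commutes with every component of the
total spin (`(𝐒_tot)² = Σ_{x,y} Σ_α Sᵅ_x Sᵅ_y` and `commute_sum_siteSpin_mul_siteSpin_totalSpin`).
Tasaki (2020) §2.2, eq. (2.2.13); App. A.3. [folklore] -/
theorem commute_totalSpinSq_totalSpin (b : Fin 3) :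
    Commute (totalSpinSq n : Op Λ (n + 1)) (totalSpin n b) := by
  have h : (totalSpinSq n : Op Λ (n + 1)) = ∑ x, ∑ y, ∑ α : Fin 3, siteSpin n x α * siteSpin n y α := by
    unfold totalSpinSq totalSpin
    simp only [Finset.sum_mul_sum]
    rw [Finset.sum_comm]
    refine Finset.sum_congr rfl fun x _ => ?_
    rw [Finset.sum_comm]
  rw [h]
  exact Commute.sum_left _ _ _ fun x _ => Commute.sum_left _ _ _ fun y _ =>
    commute_sum_siteSpin_mul_siteSpin_totalSpin n x y b

/-- `[(𝐒_tot)², Ŝ⁺_tot] = 0`. Tasaki (2020) §2.2, App. A.3. [folklore] -/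
theorem commute_totalSpinSq_raise :
    Commute (totalSpinSq n : Op Λ (n + 1)) (totalSpin n 0 + I • totalSpin n 1) :=
  (commute_totalSpinSq_totalSpin n 0).add_right ((commute_totalSpinSq_totalSpin n 1).smul_right _)

/-- `[(𝐒_tot)², Ŝ⁻_tot] = 0`. Tasaki (2020) §2.2, App. A.3. [folklore] -/
theorem commute_totalSpinSq_lower :
    Commute (totalSpinSq n : Op Λ (n + 1)) (totalSpin n 0 - I • totalSpin n 1) :=
  (commute_totalSpinSq_totalSpin n 0).sub_right ((commute_totalSpinSq_totalSpin n 1).smul_right _)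

/-! ### The Heisenberg Hamiltonian commutes with the ladder operators -/

section Graph

variable (G : SimpleGraph Λ) [DecidableRel G.Adj] (J : ℝ)

/-- `[H, Ŝ⁺_tot] = 0` for the Heisenberg Hamiltonian. Tasaki (2020) §2.5, eq. (2.5.2). [folklore] -/
theorem commute_heisenbergHamiltonian_raise :
    Commute (heisenbergHamiltonian n G J) (totalSpin n 0 + I • totalSpin n 1) :=
  (commute_heisenbergHamiltonian_totalSpin n G J 0).add_right
    ((commute_heisenbergHamiltonian_totalSpin n G J 1).smul_right _)

/-- `[H, Ŝ⁻_tot] = 0` for the Heisenberg Hamiltonian. Tasaki (2020) §2.5, eq. (2.5.2). [folklore] -/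
theorem commute_heisenbergHamiltonian_lower :
    Commute (heisenbergHamiltonian n G J) (totalSpin n 0 - I • totalSpin n 1) :=
  (commute_heisenbergHamiltonian_totalSpin n G J 0).sub_right
    ((commute_heisenbergHamiltonian_totalSpin n G J 1).smul_right _)

/-- `[H, (𝐒_tot)²] = 0` for the Heisenberg Hamiltonian. Tasaki (2020) §2.5, eq. (2.5.2). [folklore] -/
theorem commute_heisenbergHamiltonian_totalSpinSq :
    Commute (heisenbergHamiltonian n G J) (totalSpinSq n) := by
  unfold totalSpinSq
  exact Commute.sum_right _ _ _ fun α _ =>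
    (commute_heisenbergHamiltonian_totalSpin n G J α).mul_right
      (commute_heisenbergHamiltonian_totalSpin n G J α)

end Graph

end QLattice

end LiebMattis

end Literature.MathematicalPhysics.QuantumLattice
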